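import Mathlib.Analysis.Matrix.Normed
import Mathlib.Analysis.Calculus.Deriv.Mul
import Mathlib.Analysis.Calculus.FDeriv.Mul
import Mathlib.Analysis.Calculus.MeanValue
import Mathlib.LinearAlgebra.Matrix.NonsingularInverse
import Mathlib.LinearAlgebra.Matrix.ToLinearEquiv
import Mathlib.Analysis.Complex.Basic
import HarnessLib

/-!
# The matrix Riccati equation of the Gaussian-beam phase, solved through the Jacobi system

Topic `Literature/Analysis/ODE` (namespace `Literature.Analysis.ODE`, grouping sub-namespace
`GaussianBeamRiccati` for the objects of this construction). Infrastructure for the Gaussian-beam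
construction of Sbierski, *Characterisation of the energy of Gaussian beams on Lorentzian
manifolds*, Anal. PDE 8 (2015) 1379–1420, §3 (= arXiv:1311.2477v2 §2.2, pp. 11–14), after Ralston
(MAA Stud. Math. 23 (1982) 206–248): the second derivatives `M(s) = ∂∂φ(γ(s))` of the phase of a
Gaussian beam along a null geodesic `γ` must solve the **matrix Riccati equation**
`0 = A + BM + MBᵀ + MCM + Ṁ` ((2.23); `A = ∂²H/∂x∂x`, `B = ∂²H/∂x∂p`, `C = ∂²H/∂p∂p` along the
lifted geodesic, `H = ½ g⁻¹(ζ, ζ)`, so `A`, `C` are real symmetric and `B` is real), be symmetric,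
be *compatible* with the first derivatives (`M γ̇ = (dφ)˙`, (2.21)) and have imaginary part
positive definite transversally to `γ̇` — *globally* in the parameter `s`. Sbierski (following
Ralston) solves it through the linear **Jacobi system** `J̇ = BᵀJ + CV`, `V̇ = −AJ − BV` (2.24) with
`(J, V)(0) = (1, M(0))`, `M := V J⁻¹`, the point being that `J(s)` stays invertible for *complex*
data with `Im M(0) > 0` transversally, by conservation of the symplectic form `ω` along the
linearised Hamiltonian flow ((2.19)–(2.27)).

This file proves that algebraic–differential mechanism for an arbitrary finite index type and
arbitrary (pointwise symmetric / real) coefficient paths on a convex parameter set, for any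
differentiable solution `(J, V)` of the Jacobi system:

* `pairing_eq_pairing` — the bilinear symplectic pairing `Jᵀ V₂ − Vᵀ J₂` of two solutions is
  constant ((2.19));
* `conjPairing_eq_conjPairing` — for real coefficients the conjugate pair `(J̄, V̄)` is again a
  solution, so the sesquilinear pairing `Jᵀ V̄ − Vᵀ J̄` is constant (`ω(X̃, X̃‾)`);
* `det_ne_zero_of_conjPairing` — `J(s)` is invertible as long as it maps the initial velocity to a
  nonzero vector and the kernel of the Hermitian form `imForm M(0)` of `Im M(0)` is the line of
  that velocity (pp. 13–14);
* `transpose_mul_inv_of_pairing` (symmetry of `M = VJ⁻¹`), `hasDerivWithinAt_riccati` (the Riccati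
  equation), `mul_inv_mulVec_eq` (compatibility (2.21) from (2.27)),
  `transpose_mul_conj_sub_mul_conj` / `imForm_mulVec` / `exists_eq_smul_of_imForm_eq_zero` (the
  imaginary part is transported by `J`: `Jᵀ(M̄ − M)J̄ = M̄₀ − M₀`, so `Im M(s)` keeps the signature
  and the kernel line, p. 14);
* `riccati_of_jacobi` — the statements bundled along an interval, from the initial data
  `J(s₀) = 1`, `V(s₀) = M₀` symmetric.

What is NOT here: the existence of `(J, V)` (a linear ODE; the tree's
`Literature.Analysis.ODE.exists_solution_linear`) and the identification `J x₀ = γ̇`, `V x₀ = (dφ)˙`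
of (2.27) by uniqueness, which belong with the application; the Liouville formula for `det J`; any
Lorentzian geometry (the coefficient paths are abstract).

## Implementation

Matrices over `ℂ` with real structure expressed by `X.map conj = X`; norms on `Matrix n n ℂ` are
the scoped `Matrix.Norms.Operator` instances (any norm would do: only `HasDerivWithinAt` and the
mean value inequality are used); the derivative of `J⁻¹` is Mathlib's `hasFDerivAt_ringInverse` in
that Banach algebra. Conservation laws are obtained from "derivative zero on a convex set"
(`Convex.norm_image_sub_le_of_norm_hasDerivWithin_le`), so no interior or unique-differentiability
hypothesis on the parameter set is needed.

## References

* J. Sbierski, Anal. PDE 8 (2015) 1379–1420, doi:10.2140/apde.2015.8.1379, §3 (arXiv:1311.2477v2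
  §2.2, pp. 11–14, equations (2.19)–(2.27)) (key `Sbierski2015`).
* J. Ralston, *Gaussian beams and the propagation of singularities*, in: Studies in partial
  differential equations, MAA Stud. Math. 23 (1982) 206–248 (Sbierski's [Ral83]).
-/

noncomputable section

open Set Matrix
open scoped Matrix.Norms.Operator ComplexConjugate

namespace Literature.Analysis.ODE

namespace GaussianBeamRiccati

variable {n : Type*} [Fintype n] [DecidableEq n]

/-! ### The symplectic pairing of two solutions of the Jacobi system is conserved -/

/-- **Conservation of the symplectic pairing.** If `(J, V)` and `(J₂, V₂)` solve the Jacobi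
system `J' = Bᵀ J + C V`, `V' = −A J − B V` on a convex set of parameters, with `A`, `C`
symmetric, then `Jᵀ V₂ − Vᵀ J₂` is constant there (Sbierski, Anal. PDE 8 (2015), §3 =
arXiv:1311.2477 §2.2, (2.19): the Hamiltonian flow preserves the symplectic form, so
"`ω(X̃(s), X̂(s)) = (J̃ Ṽ) [[0, 1], [−1, 0]] (Ĵ; V̂)` is constant" for vector solutions; here for all
columns at once). [cite: Sbierski2015, §3 (arXiv §2.2, (2.19))] -/
theorem pairing_eq_pairing {I : Set ℝ} (hI : Convex ℝ I) {A B C : ℝ → Matrix n n ℂ}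
    (hA : ∀ s ∈ I, (A s)ᵀ = A s) (hC : ∀ s ∈ I, (C s)ᵀ = C s)
    {J V J₂ V₂ : ℝ → Matrix n n ℂ}
    (hJ : ∀ s ∈ I, HasDerivWithinAt J ((B s)ᵀ * J s + C s * V s) I s)
    (hV : ∀ s ∈ I, HasDerivWithinAt V (-(A s * J s) - B s * V s) I s)
    (hJ₂ : ∀ s ∈ I, HasDerivWithinAt J₂ ((B s)ᵀ * J₂ s + C s * V₂ s) I s)
    (hV₂ : ∀ s ∈ I, HasDerivWithinAt V₂ (-(A s * J₂ s) - B s * V₂ s) I s)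
    {s s' : ℝ} (hs : s ∈ I) (hs' : s' ∈ I) :
    (J s)ᵀ * V₂ s - (V s)ᵀ * J₂ s = (J s')ᵀ * V₂ s' - (V s')ᵀ * J₂ s' := by
  -- transposition is a continuous linear map
  set T : Matrix n n ℂ →L[ℝ] Matrix n n ℂ :=
    LinearMap.toContinuousLinearMap
      ((Matrix.transposeLinearEquiv n n ℝ ℂ : Matrix n n ℂ ≃ₗ[ℝ] Matrix n n ℂ) :
        Matrix n n ℂ →ₗ[ℝ] Matrix n n ℂ) with hT
  have hTapply : ∀ X : Matrix n n ℂ, T X = Xᵀ := fun X ↦ rfl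
  have hJt : ∀ σ ∈ I, HasDerivWithinAt (fun σ ↦ (J σ)ᵀ) ((J σ)ᵀ * B σ + (V σ)ᵀ * C σ) I σ := by
    intro σ hσ
    have h := T.hasFDerivAt.comp_hasDerivWithinAt σ (hJ σ hσ)
    have h' : T ((B σ)ᵀ * J σ + C σ * V σ) = (J σ)ᵀ * B σ + (V σ)ᵀ * C σ := by
      rw [hTapply, transpose_add, transpose_mul, transpose_mul, transpose_transpose, hC σ hσ]
    exact h.congr_deriv h'
  have hVt : ∀ σ ∈ I, HasDerivWithinAt (fun σ ↦ (V σ)ᵀ) (-((J σ)ᵀ * A σ) - (V σ)ᵀ * (B σ)ᵀ) I σ := by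
    intro σ hσ
    have h := T.hasFDerivAt.comp_hasDerivWithinAt σ (hV σ hσ)
    have h' : T (-(A σ * J σ) - B σ * V σ) = -((J σ)ᵀ * A σ) - (V σ)ᵀ * (B σ)ᵀ := by
      rw [hTapply, transpose_sub, transpose_neg, transpose_mul, transpose_mul, hA σ hσ]
    exact h.congr_deriv h'
  -- the pairing has derivative zero
  have hW : ∀ σ ∈ I, HasDerivWithinAt (fun σ ↦ (J σ)ᵀ * V₂ σ - (V σ)ᵀ * J₂ σ) 0 I σ := by
    intro σ hσ
    have h := ((hJt σ hσ).mul (hV₂ σ hσ)).sub ((hVt σ hσ).mul (hJ₂ σ hσ))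
    refine h.congr_deriv ?_
    noncomm_ring
  have h := hI.norm_image_sub_le_of_norm_hasDerivWithin_le (C := 0) hW (fun σ _ ↦ by simp) hs hs'
  rw [zero_mul, norm_le_zero_iff, sub_eq_zero] at h
  exact h.symm

/-- **Conservation of the sesquilinear symplectic pairing.** If `(J, V)` solves the Jacobi system
with *real* coefficients `A`, `B`, `C` (`A`, `C` symmetric), then so does `(J̄, V̄)`, whence
`Jᵀ V̄ − Vᵀ J̄` is constant (Sbierski, Anal. PDE 8 (2015), §3 = arXiv:1311.2477 §2.2, (2.19):
"`ω(X̃(s), X̂(s))` is constant", applied to `X̂ = X̄`). [cite: Sbierski2015, §3 (arXiv §2.2, (2.19))] -/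
theorem conjPairing_eq_conjPairing {I : Set ℝ} (hI : Convex ℝ I) {A B C : ℝ → Matrix n n ℂ}
    (hA : ∀ s ∈ I, (A s)ᵀ = A s) (hC : ∀ s ∈ I, (C s)ᵀ = C s)
    (hAr : ∀ s ∈ I, (A s).map conj = A s) (hBr : ∀ s ∈ I, (B s).map conj = B s)
    (hCr : ∀ s ∈ I, (C s).map conj = C s)
    {J V : ℝ → Matrix n n ℂ}
    (hJ : ∀ s ∈ I, HasDerivWithinAt J ((B s)ᵀ * J s + C s * V s) I s)
    (hV : ∀ s ∈ I, HasDerivWithinAt V (-(A s * J s) - B s * V s) I s)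
    {s s' : ℝ} (hs : s ∈ I) (hs' : s' ∈ I) :
    (J s)ᵀ * (V s).map conj - (V s)ᵀ * (J s).map conj =
      (J s')ᵀ * (V s').map conj - (V s')ᵀ * (J s').map conj := by
  -- entrywise complex conjugation is a continuous real-linear map
  set Cj : Matrix n n ℂ →L[ℝ] Matrix n n ℂ := LinearMap.toContinuousLinearMap
    ((Complex.conjAe.toLinearMap).mapMatrix : Matrix n n ℂ →ₗ[ℝ] Matrix n n ℂ) with hCj
  have hCj_apply : ∀ X : Matrix n n ℂ, Cj X = X.map conj := fun X ↦ rfl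
  -- the conjugate pair solves the same system
  have hJc : ∀ σ ∈ I, HasDerivWithinAt (fun σ ↦ (J σ).map conj)
      ((B σ)ᵀ * (J σ).map conj + C σ * (V σ).map conj) I σ := by
    intro σ hσ
    have h := Cj.hasFDerivAt.comp_hasDerivWithinAt σ (hJ σ hσ)
    have h' : Cj ((B σ)ᵀ * J σ + C σ * V σ) = (B σ)ᵀ * (J σ).map conj + C σ * (V σ).map conj := by
      rw [map_add, hCj_apply, hCj_apply, Matrix.map_mul, Matrix.map_mul, transpose_map, hBr σ hσ,
        hCr σ hσ]
    exact h.congr_deriv h'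
  have hVc : ∀ σ ∈ I, HasDerivWithinAt (fun σ ↦ (V σ).map conj)
      (-(A σ * (J σ).map conj) - B σ * (V σ).map conj) I σ := by
    intro σ hσ
    have h := Cj.hasFDerivAt.comp_hasDerivWithinAt σ (hV σ hσ)
    have h' : Cj (-(A σ * J σ) - B σ * V σ) = -(A σ * (J σ).map conj) - B σ * (V σ).map conj := by
      rw [map_sub, map_neg, hCj_apply, hCj_apply, Matrix.map_mul, Matrix.map_mul, hAr σ hσ,
        hBr σ hσ]
    exact h.congr_deriv h'
  exact pairing_eq_pairing hI hA hC hJ hV hJc hVc hs hs'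

/-! ### Algebra at a fixed parameter: invertibility of `J`, symmetry of `M = V J⁻¹`, transport of
the imaginary part -/

omit [DecidableEq n] in
/-- Conjugating a matrix–vector product entrywise. [folklore] -/
theorem map_conj_mulVec_star (X : Matrix n n ℂ) (f : n → ℂ) :
    X.map conj *ᵥ star f = star (X *ᵥ f) := by
  ext i
  simp [Matrix.mulVec, dotProduct, star_sum]

/-- **The Hermitian form of the imaginary part** of a complex matrix `M`:
`imForm M f = ∑_{ij} Im(M_{ij}) f_i f̄_j`, written as `(i/2) · fᵀ (M̄ − M) f̄` (the conserved
sesquilinear pairing of the Jacobi system is `Jᵀ V̄ − Vᵀ J̄ = Jᵀ (M̄ − M) J̄ = −2i Jᵀ Im(M) J̄`;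
Sbierski, loc. cit., p. 14: "`ω(X̃_f, X̃_f‾) = −2i [Im(M(s)) J(s)f]·[J(s)f]‾`"). For `M` symmetric
this is the value of the real quadratic form `Im M` on `f`, extended sesquilinearly.
[cite: Sbierski2015, §3 (arXiv §2.2, p. 14)] -/
def imForm (M : Matrix n n ℂ) (f : n → ℂ) : ℂ :=
  Complex.I / 2 * (f ⬝ᵥ ((M.map conj - M) *ᵥ star f))

omit [Fintype n] [DecidableEq n] in
/-- `conj m − m = −2i Im(m)` (Mathlib's `Complex.sub_conj`). [folklore] -/
theorem conj_sub_self (m : ℂ) : conj m - m = -(((2 * m.im : ℝ) : ℂ) * Complex.I) := by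
  rw [← neg_sub, Complex.sub_conj]

omit [DecidableEq n] in
/-- `imForm M f = ∑_{ij} Im(M_{ij}) f_i f̄_j`. [folklore] -/
theorem imForm_eq_sum (M : Matrix n n ℂ) (f : n → ℂ) :
    imForm M f = ∑ i, ∑ j, ((M i j).im : ℂ) * (f i * star (f j)) := by
  unfold imForm
  simp only [dotProduct, Matrix.mulVec, Matrix.sub_apply, Matrix.map_apply, conj_sub_self,
    Pi.star_apply, Finset.mul_sum]
  refine Finset.sum_congr rfl fun i _ ↦ Finset.sum_congr rfl fun j _ ↦ ?_
  have hI : Complex.I * Complex.I = -1 := Complex.I_mul_I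
  push_cast
  linear_combination (-(↑(M i j).im * f i * star (f j))) * hI

omit [DecidableEq n] in
/-- `imForm M f = 0` iff the raw pairing `fᵀ (M̄ − M) f̄` vanishes. [folklore] -/
theorem imForm_eq_zero_iff (M : Matrix n n ℂ) (f : n → ℂ) :
    imForm M f = 0 ↔ f ⬝ᵥ ((M.map conj - M) *ᵥ star f) = 0 := by
  unfold imForm
  rw [mul_eq_zero, or_iff_right]
  exact div_ne_zero Complex.I_ne_zero two_ne_zero

/-- **`J(s)` is invertible** (Sbierski, loc. cit., pp. 1390–1391 = arXiv pp. 13–14). At a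
parameter where the conserved sesquilinear pairing has its initial value `M̄₀ − M₀` (`J(0) = 1`,
`V(0) = M₀` symmetric), where `J` maps the initial velocity `x₀ = γ̇(0)` to a nonzero vector
`x = γ̇(s)`, and where the kernel of the Hermitian form `f ↦ fᵀ(M̄₀ − M₀)f̄ = −2i fᵀ Im(M₀) f̄` is
the complex line of `x₀` ("`Im(M(0))` is positive definite on a three dimensional subspace
transversal to `γ̇`"), the matrix `J` has nonzero determinant: a kernel vector `f` would have
vanishing pairing, hence `f = z x₀`, hence `0 = J f = z x ≠ 0`.
[cite: Sbierski2015, §3 (arXiv §2.2, pp. 13–14)] -/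
theorem det_ne_zero_of_conjPairing {Jm Vm M₀ : Matrix n n ℂ} {x₀ x : n → ℂ} (hx : x ≠ 0)
    (hpair : Jmᵀ * Vm.map conj - Vmᵀ * Jm.map conj = M₀.map conj - M₀)
    (hker : ∀ f : n → ℂ, imForm M₀ f = 0 → ∃ z : ℂ, f = z • x₀)
    (hJx : Jm *ᵥ x₀ = x) : Jm.det ≠ 0 := by
  intro hdet
  obtain ⟨f, hf0, hf⟩ := Matrix.exists_mulVec_eq_zero_iff.2 hdet
  -- the pairing of the kernel vector vanishes
  have hzero : f ⬝ᵥ ((M₀.map conj - M₀) *ᵥ star f) = 0 := by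
    rw [← hpair, Matrix.sub_mulVec, dotProduct_sub, ← mulVec_mulVec, ← mulVec_mulVec,
      dotProduct_mulVec f Jmᵀ, vecMul_transpose, hf, zero_dotProduct, map_conj_mulVec_star, hf,
      star_zero, mulVec_zero, dotProduct_zero, sub_zero]
  obtain ⟨z, rfl⟩ := hker f ((imForm_eq_zero_iff M₀ f).2 hzero)
  rw [mulVec_smul, hJx] at hf
  rcases smul_eq_zero.1 hf with hz | hx0
  · exact hf0 (by rw [hz, zero_smul])
  · exact hx hx0

/-- **`M = V J⁻¹` is symmetric** when the bilinear pairing `Jᵀ V − Vᵀ J` vanishes (its initial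
value for `J(0) = 1`, `V(0) = M₀` symmetric) and `J` is invertible (Sbierski, loc. cit.: "Since
`M(0)` is chosen to be symmetric and the Riccati equation is invariant under transposition, it
follows that `M(s)` is symmetric"). [cite: Sbierski2015, §3 (arXiv §2.2, p. 14)] -/
theorem transpose_mul_inv_of_pairing {Jm Vm : Matrix n n ℂ} (hJ : IsUnit Jm.det)
    (hW : Jmᵀ * Vm = Vmᵀ * Jm) : (Vm * Jm⁻¹)ᵀ = Vm * Jm⁻¹ := by
  have hJt : IsUnit Jmᵀ.det := by rwa [det_transpose]
  calc (Vm * Jm⁻¹)ᵀ = Jm⁻¹ᵀ * Vmᵀ := transpose_mul _ _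
    _ = Jmᵀ⁻¹ * Vmᵀ := by rw [transpose_nonsing_inv]
    _ = Jmᵀ⁻¹ * (Vmᵀ * Jm * Jm⁻¹) := by rw [mul_nonsing_inv_cancel_right _ _ hJ]
    _ = Jmᵀ⁻¹ * (Jmᵀ * Vm * Jm⁻¹) := by rw [hW]
    _ = Vm * Jm⁻¹ := by rw [Matrix.mul_assoc, nonsing_inv_mul_cancel_left _ _ hJt]

/-- **Transport of the imaginary part.** With `M = V J⁻¹` symmetric and `J` invertible, the
conserved sesquilinear pairing reads `Jᵀ (M̄ − M) J̄ = M̄₀ − M₀`, i.e.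
`[Im M(s)] J(s)f · J̄(s)f̄ = [Im M(0)] f · f̄` (Sbierski, loc. cit., p. 14, last display of the
construction of `φ`). [cite: Sbierski2015, §3 (arXiv §2.2, p. 14)] -/
theorem transpose_mul_conj_sub_mul_conj {Jm Vm M₀ : Matrix n n ℂ} (hJ : IsUnit Jm.det)
    (hsymm : (Vm * Jm⁻¹)ᵀ = Vm * Jm⁻¹)
    (hpair : Jmᵀ * Vm.map conj - Vmᵀ * Jm.map conj = M₀.map conj - M₀) :
    Jmᵀ * ((Vm * Jm⁻¹).map conj - Vm * Jm⁻¹) * Jm.map conj = M₀.map conj - M₀ := by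
  have h1 : (Vm * Jm⁻¹).map conj * Jm.map conj = Vm.map conj := by
    rw [← Matrix.map_mul, nonsing_inv_mul_cancel_right _ _ hJ]
  have h2 : Jmᵀ * (Vm * Jm⁻¹) = Vmᵀ := by
    rw [← hsymm, transpose_mul, ← Matrix.mul_assoc, ← transpose_mul, nonsing_inv_mul _ hJ,
      transpose_one, Matrix.one_mul]
  rw [Matrix.mul_sub, Matrix.sub_mul, Matrix.mul_assoc Jmᵀ ((Vm * Jm⁻¹).map conj) (Jm.map conj),
    h1, h2, hpair]

omit [DecidableEq n] in
/-- The Hermitian form of the imaginary part is transported by `J`: for every `f`,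
`(J f)ᵀ (M̄ − M) (J̄ f̄) = fᵀ (M̄₀ − M₀) f̄`. [cite: Sbierski2015, §3 (arXiv §2.2, p. 14)] -/
theorem dotProduct_imForm_mulVec {Jm Mm M₀ : Matrix n n ℂ}
    (h : Jmᵀ * (Mm.map conj - Mm) * Jm.map conj = M₀.map conj - M₀) (f : n → ℂ) :
    (Jm *ᵥ f) ⬝ᵥ ((Mm.map conj - Mm) *ᵥ star (Jm *ᵥ f)) = f ⬝ᵥ ((M₀.map conj - M₀) *ᵥ star f) := by
  rw [← h, ← map_conj_mulVec_star, ← mulVec_mulVec, ← mulVec_mulVec, dotProduct_mulVec _ Jmᵀ,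
    vecMul_transpose]

/-- **Compatibility with the first derivatives**: `M x = ξ` for `M = V J⁻¹` whenever `J x₀ = x`
and `V x₀ = ξ` (Sbierski, loc. cit., (2.21)–(2.22): `M_{μν}(s) γ̇^ν(s) = (∂_μφ)˙(s)`).
[cite: Sbierski2015, §3 (arXiv §2.2, (2.21)–(2.22))] -/
theorem mul_inv_mulVec_eq {Jm Vm : Matrix n n ℂ} (hJ : IsUnit Jm.det) {x₀ x ξ : n → ℂ}
    (hJx : Jm *ᵥ x₀ = x) (hVx : Vm *ᵥ x₀ = ξ) : (Vm * Jm⁻¹) *ᵥ x = ξ := by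
  rw [← hJx, ← mulVec_mulVec, mulVec_mulVec _ Jm⁻¹, nonsing_inv_mul _ hJ, one_mulVec, hVx]

omit [DecidableEq n] in
/-- **The imaginary part is transported by `J`** at the level of the Hermitian form:
`imForm M (J f) = imForm M₀ f` whenever `Jᵀ (M̄ − M) J̄ = M̄₀ − M₀`.
[cite: Sbierski2015, §3 (arXiv §2.2, p. 14)] -/
theorem imForm_mulVec {Jm Mm M₀ : Matrix n n ℂ}
    (h : Jmᵀ * (Mm.map conj - Mm) * Jm.map conj = M₀.map conj - M₀) (f : n → ℂ) :
    imForm Mm (Jm *ᵥ f) = imForm M₀ f := by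
  unfold imForm
  rw [dotProduct_imForm_mulVec h]

/-- The same transport read from an arbitrary vector `g = J (J⁻¹ g)` when `J` is invertible:
`imForm M g = imForm M₀ (J⁻¹ g)`. [cite: Sbierski2015, §3 (arXiv §2.2, p. 14)] -/
theorem imForm_eq_imForm_inv_mulVec {Jm Mm M₀ : Matrix n n ℂ} (hJ : IsUnit Jm.det)
    (h : Jmᵀ * (Mm.map conj - Mm) * Jm.map conj = M₀.map conj - M₀) (g : n → ℂ) :
    imForm Mm g = imForm M₀ (Jm⁻¹ *ᵥ g) := by
  rw [← imForm_mulVec h, mulVec_mulVec, mul_nonsing_inv _ hJ, one_mulVec]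

/-- **The kernel of the imaginary part is transported**: if the kernel of `imForm M₀` is the
complex line of `x₀` and `J x₀ = x`, then the kernel of `imForm M` (with `M`, `J`, `M₀` as in
the transport identity) is the complex line of `x` — "`Im(M(s))` stays positive definite on a
three dimensional subspace transversal to `γ̇(s)`" (Sbierski, loc. cit., p. 14).
[cite: Sbierski2015, §3 (arXiv §2.2, p. 14)] -/
theorem exists_eq_smul_of_imForm_eq_zero {Jm Mm M₀ : Matrix n n ℂ} (hJ : IsUnit Jm.det)
    (h : Jmᵀ * (Mm.map conj - Mm) * Jm.map conj = M₀.map conj - M₀) {x₀ x : n → ℂ}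
    (hker : ∀ f : n → ℂ, imForm M₀ f = 0 → ∃ z : ℂ, f = z • x₀) (hJx : Jm *ᵥ x₀ = x)
    {g : n → ℂ} (hg : imForm Mm g = 0) : ∃ z : ℂ, g = z • x := by
  rw [imForm_eq_imForm_inv_mulVec hJ h] at hg
  obtain ⟨z, hz⟩ := hker _ hg
  refine ⟨z, ?_⟩
  have : Jm *ᵥ (Jm⁻¹ *ᵥ g) = g := by rw [mulVec_mulVec, mul_nonsing_inv _ hJ, one_mulVec]
  rw [← this, hz, mulVec_smul, hJx]

/-! ### Calculus: the derivative of `M = V J⁻¹` and the Riccati equation -/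

/-- The derivative of the inverse along a differentiable path of invertible matrices:
`(J⁻¹)' = −J⁻¹ J' J⁻¹` (Mathlib's `hasFDerivAt_ringInverse` in the Banach algebra of matrices).
[folklore] -/
theorem hasDerivWithinAt_inv {J : ℝ → Matrix n n ℂ} {J' : Matrix n n ℂ} {I : Set ℝ} {s : ℝ}
    (hJ : HasDerivWithinAt J J' I s) (hu : IsUnit (J s).det) :
    HasDerivWithinAt (fun σ ↦ (J σ)⁻¹) (-((J s)⁻¹ * J' * (J s)⁻¹)) I s := by
  obtain ⟨u, hu'⟩ := (Matrix.isUnit_iff_isUnit_det _).2 hu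
  have h := (hasFDerivAt_ringInverse (𝕜 := ℝ) u).comp_hasDerivWithinAt_of_eq s hJ hu'
  have hfun : (Ring.inverse ∘ J) = fun σ ↦ (J σ)⁻¹ := by
    funext σ
    simp [nonsing_inv_eq_ringInverse]
  rw [hfun] at h
  refine h.congr_deriv ?_
  simp [ContinuousLinearMap.mulLeftRight_apply, Matrix.coe_units_inv, hu']

/-- The derivative of `M = V J⁻¹` along differentiable paths `J` (invertible at `s`) and `V`:
`M' = V' J⁻¹ − V J⁻¹ J' J⁻¹`. [folklore] -/
theorem hasDerivWithinAt_mul_inv {J V : ℝ → Matrix n n ℂ} {J' V' : Matrix n n ℂ} {I : Set ℝ}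
    {s : ℝ} (hJ : HasDerivWithinAt J J' I s) (hV : HasDerivWithinAt V V' I s)
    (hu : IsUnit (J s).det) :
    HasDerivWithinAt (fun σ ↦ V σ * (J σ)⁻¹) (V' * (J s)⁻¹ - V s * ((J s)⁻¹ * J' * (J s)⁻¹)) I s := by
  have h := hV.mul (hasDerivWithinAt_inv hJ hu)
  refine h.congr_deriv ?_
  noncomm_ring

/-- **The Riccati equation.** If `(J, V)` solves the Jacobi system `J' = Bᵀ J + C V`,
`V' = −A J − B V` at `s` and `J(s)` is invertible, then `M = V J⁻¹` satisfies
`M' = −(A + B M + M Bᵀ + M C M)` at `s` (Sbierski, loc. cit., (2.23)–(2.24): "If `J` is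
invertible then it is an easy exercise to verify that `M := V J⁻¹` solves (2.23)").
[cite: Sbierski2015, §3 (arXiv §2.2, (2.23)–(2.24))] -/
theorem hasDerivWithinAt_riccati {J V : ℝ → Matrix n n ℂ} {A B C : Matrix n n ℂ} {I : Set ℝ}
    {s : ℝ} (hJ : HasDerivWithinAt J (Bᵀ * J s + C * V s) I s)
    (hV : HasDerivWithinAt V (-(A * J s) - B * V s) I s) (hu : IsUnit (J s).det) :
    HasDerivWithinAt (fun σ ↦ V σ * (J σ)⁻¹)
      (-A - B * (V s * (J s)⁻¹) - V s * (J s)⁻¹ * Bᵀ - V s * (J s)⁻¹ * C * (V s * (J s)⁻¹)) I s := by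
  have h := hasDerivWithinAt_mul_inv hJ hV hu
  set K : Matrix n n ℂ := (J s)⁻¹ with hK
  have hJK : J s * K = 1 := mul_nonsing_inv _ hu
  have e1 : A * J s * K = A := by rw [Matrix.mul_assoc, hJK, Matrix.mul_one]
  have e2 : Bᵀ * J s * K = Bᵀ := by rw [Matrix.mul_assoc, hJK, Matrix.mul_one]
  have key : (-(A * J s) - B * V s) * K - V s * (K * (Bᵀ * J s + C * V s) * K) =
      -A - B * (V s * K) - V s * K * Bᵀ - V s * K * C * (V s * K) := by
    conv_rhs => rw [← e1, ← e2]
    noncomm_ring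
  exact h.congr_deriv key

/-! ### The construction along an interval -/

/-- **Sbierski's construction of the second derivatives of the Gaussian-beam phase** (Anal. PDE 8
(2015), §3 = arXiv:1311.2477 §2.2, pp. 12–14), as a theorem about the Jacobi system. Let `A`, `B`,
`C` be real matrix functions on a convex set `I` of parameters with `A`, `C` symmetric (the blocks
`∂²H/∂x∂x`, `∂²H/∂x∂p`, `∂²H/∂p∂p` of the Hessian of `H = ½ g⁻¹(ζ, ζ)` along the lifted geodesic),
let `(J, V)` solve `J' = Bᵀ J + C V`, `V' = −A J − B V` on `I` with `J(s₀) = 1`, `V(s₀) = M₀`,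
`M₀` symmetric, let `J x₀ = x`, `V x₀ = ξ` with `x(s) ≠ 0` (in the application `x = γ̇`,
`ξ = (dφ)˙`, (2.27)), and suppose the kernel of the imaginary part of `M₀` is the complex line of
`x₀` (`Im M(0)` "positive definite on a three dimensional subspace […] transversal to `γ̇`").
Then for every `s ∈ I`: `J(s)` is invertible; `M(s) := V(s) J(s)⁻¹` is symmetric, solves the
Riccati equation `M' = −(A + BM + MBᵀ + MCM)` within `I` at `s`, and is compatible with the first
derivatives, `M(s) x(s) = ξ(s)`; and the imaginary part is transported,
`J(s)ᵀ (M̄(s) − M(s)) J̄(s) = M̄₀ − M₀`, so that `imForm (M s)` takes the values of `imForm M₀`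
(`imForm_eq_imForm_inv_mulVec`) and its kernel is the complex line of `x(s)`
(`exists_eq_smul_of_imForm_eq_zero`). [cite: Sbierski2015, §3 (arXiv §2.2, pp. 12–14)] -/
theorem riccati_of_jacobi {I : Set ℝ} (hI : Convex ℝ I) {s₀ : ℝ} (hs₀ : s₀ ∈ I)
    {A B C : ℝ → Matrix n n ℂ} (hA : ∀ s ∈ I, (A s)ᵀ = A s) (hC : ∀ s ∈ I, (C s)ᵀ = C s)
    (hAr : ∀ s ∈ I, (A s).map conj = A s) (hBr : ∀ s ∈ I, (B s).map conj = B s)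
    (hCr : ∀ s ∈ I, (C s).map conj = C s)
    {J V : ℝ → Matrix n n ℂ}
    (hJ : ∀ s ∈ I, HasDerivWithinAt J ((B s)ᵀ * J s + C s * V s) I s)
    (hV : ∀ s ∈ I, HasDerivWithinAt V (-(A s * J s) - B s * V s) I s)
    {M₀ : Matrix n n ℂ} (hJ₀ : J s₀ = 1) (hV₀ : V s₀ = M₀) (hM₀ : M₀ᵀ = M₀)
    {x₀ : n → ℂ} {x ξ : ℝ → n → ℂ} (hx : ∀ s ∈ I, x s ≠ 0)
    (hJx : ∀ s ∈ I, J s *ᵥ x₀ = x s) (hVx : ∀ s ∈ I, V s *ᵥ x₀ = ξ s)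
    (hker : ∀ f : n → ℂ, imForm M₀ f = 0 → ∃ z : ℂ, f = z • x₀) {s : ℝ} (hs : s ∈ I) :
    IsUnit (J s).det ∧
    (V s * (J s)⁻¹)ᵀ = V s * (J s)⁻¹ ∧
    HasDerivWithinAt (fun σ ↦ V σ * (J σ)⁻¹)
      (-A s - B s * (V s * (J s)⁻¹) - V s * (J s)⁻¹ * (B s)ᵀ -
        V s * (J s)⁻¹ * C s * (V s * (J s)⁻¹)) I s ∧
    (V s * (J s)⁻¹) *ᵥ x s = ξ s ∧
    (J s)ᵀ * ((V s * (J s)⁻¹).map conj - V s * (J s)⁻¹) * (J s).map conj = M₀.map conj - M₀ := by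
  -- the two conserved pairings, evaluated against their initial values
  have hW : (J s)ᵀ * V s - (V s)ᵀ * J s = 0 := by
    rw [pairing_eq_pairing hI hA hC hJ hV hJ hV hs hs₀, hJ₀, hV₀, transpose_one, Matrix.one_mul,
      Matrix.mul_one, hM₀, sub_self]
  have hH : (J s)ᵀ * (V s).map conj - (V s)ᵀ * (J s).map conj = M₀.map conj - M₀ := by
    rw [conjPairing_eq_conjPairing hI hA hC hAr hBr hCr hJ hV hs hs₀, hJ₀, hV₀, transpose_one,
      Matrix.one_mul, hM₀, Matrix.map_one _ (map_zero _) (map_one _), Matrix.mul_one]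
  have hdet : IsUnit (J s).det :=
    isUnit_iff_ne_zero.2 (det_ne_zero_of_conjPairing (hx s hs) hH hker (hJx s hs))
  have hsymm : (V s * (J s)⁻¹)ᵀ = V s * (J s)⁻¹ :=
    transpose_mul_inv_of_pairing hdet (sub_eq_zero.1 hW)
  exact ⟨hdet, hsymm, hasDerivWithinAt_riccati (hJ s hs) (hV s hs) hdet,
    mul_inv_mulVec_eq hdet (hJx s hs) (hVx s hs), transpose_mul_conj_sub_mul_conj hdet hsymm hH⟩

end GaussianBeamRiccati

end Literature.Analysis.ODE

end
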